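import Summits.CriticalPhenomena.PercolationContinuityZ3.Theorems.PercNearOneGluingNoHeavyLowerTailSahiOneStepThresholdStep
import Summits.CriticalPhenomena.PercolationContinuityZ3.Theorems.PercNearOneGluingNoHeavyLowerTailSahiOneStepLayerMonotone
import HarnessLib

/-!
# One-step scheme, `(2′)` half at uniform density — OPPOSITE COMPRESSION (two-coordinate shifts) does not increase `n`

Support file (prover prim-ineq-prove-3 gen 21; `--supports stmt-CriticalPhenomena-4575`; memo
`run/shared/lean/prim/prim-ineq-prove-3/PROOF-2PRIME-UNIFORM.md`, Lemmas 3 and 4).  No definitions, no named facts, no sorries, no `native_decide`.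

Two coordinates `e ≠ j`, the transposition `τ = Equiv.swap e j`, and for a configuration `ω` its swap `ω^τ = {x | τ x ∈ ω}`.  The COMPRESSION of a family
`A` TOWARDS `e` (along `j`) is the family `C` characterised by
  `ω ∈ C ↔ (ω ∈ A ∧ ω^τ ∈ A) ∨ (e ∈ ω ∧ j ∉ ω ∧ (ω ∈ A ∨ ω^τ ∈ A))`
(no definition is introduced: every statement takes this characterisation as a hypothesis `hC`).  Results (memo Lemma 3):
* `isUpperSet_of_compress` — the compression of an increasing family is increasing; `determinedBy_of_compress`;
* `ind_compress_add_ind_compress` — on every `τ`-orbit `{ω, ω^τ}` the compression keeps the number of members, and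
  `ind_compress_inter_le` — for the compressions of `A` towards `e` and of `B` towards `j` the number of COMMON members on an orbit does not increase;
The measure-level consequences (memo Lemma 3 (a),(c), `n(H; C_A, C_B) ≤ n(H; A, B)`) and the potential / hull lemmas of memo Lemma 4 are in
the companion file `…SahiOneStepUniformShiftMeasure`.
-/

noncomputable section

namespace Summit.CriticalPhenomena.PercolationContinuityZ3.Theorems

namespace SahiOneStep

open MeasureTheory Finset
open Literature.Probability.Percolation (DeterminedBy determinedBy_iff)
open Literature.Probability.LatticeModels (prodBernoulli)
open Literature.Probability.Percolation.DecisionTree (ind ind_of_mem ind_of_not_mem ind_nonneg wtW wtW_nonneg)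
open Literature.Probability.Percolation.BHK2006 (ind_inter)
open scoped Classical

variable {ι : Type*} [Fintype ι]

/-! ## The swap of a configuration -/

omit [Fintype ι] in
/-- `e ∈ ω^τ ↔ j ∈ ω`. [folklore] -/
theorem mem_swapSet_left (e j : ι) (ω : Set ι) : e ∈ {x : ι | Equiv.swap e j x ∈ ω} ↔ j ∈ ω := by
  rw [Set.mem_setOf_eq, Equiv.swap_apply_left]

omit [Fintype ι] in
/-- `j ∈ ω^τ ↔ e ∈ ω`. [folklore] -/
theorem mem_swapSet_right (e j : ι) (ω : Set ι) : j ∈ {x : ι | Equiv.swap e j x ∈ ω} ↔ e ∈ ω := by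
  rw [Set.mem_setOf_eq, Equiv.swap_apply_right]

omit [Fintype ι] in
/-- Off `e, j` the swap changes nothing. [folklore] -/
theorem mem_swapSet_of_ne {e j x : ι} (hxe : x ≠ e) (hxj : x ≠ j) (ω : Set ι) :
    x ∈ {x : ι | Equiv.swap e j x ∈ ω} ↔ x ∈ ω := by
  rw [Set.mem_setOf_eq, Equiv.swap_apply_of_ne_of_ne hxe hxj]

omit [Fintype ι] in
/-- The swap is an involution. [folklore] -/
theorem swapSet_swapSet (e j : ι) (ω : Set ι) :
    {x : ι | Equiv.swap e j x ∈ {x : ι | Equiv.swap e j x ∈ ω}} = ω := by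
  ext x; simp only [Set.mem_setOf_eq, Equiv.swap_apply_self]

omit [Fintype ι] in
/-- A configuration containing both `e, j` or neither is fixed by the swap. [folklore] -/
theorem swapSet_eq_self {e j : ι} {ω : Set ι} (h : e ∈ ω ↔ j ∈ ω) : {x : ι | Equiv.swap e j x ∈ ω} = ω := by
  ext x
  rw [Set.mem_setOf_eq]
  by_cases hxe : x = e
  · subst hxe; rw [Equiv.swap_apply_left]; exact h.symm
  · by_cases hxj : x = j
    · subst hxj; rw [Equiv.swap_apply_right]; exact h
    · rw [Equiv.swap_apply_of_ne_of_ne hxe hxj]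

omit [Fintype ι] in
/-- The swapped pattern: `↑(S.image τ) = (↑S)^τ`. [folklore] -/
theorem coe_image_swap (e j : ι) (S : Finset ι) :
    ((S.image (Equiv.swap e j) : Finset ι) : Set ι) = {x : ι | Equiv.swap e j x ∈ (↑S : Set ι)} := by
  ext x
  simp only [Finset.coe_image, Set.mem_image, Finset.mem_coe, Set.mem_setOf_eq]
  constructor
  · rintro ⟨y, hy, rfl⟩; rwa [Equiv.swap_apply_self]
  · intro hx; exact ⟨_, hx, Equiv.swap_apply_self _ _ _⟩

/-! ## Compression preserves up-sets and determinedness -/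

omit [Fintype ι] in
/-- **The compression of an increasing family is increasing.** [folklore] -/
theorem isUpperSet_of_compress {e j : ι} (hej : e ≠ j) {A C : Set (Set ι)} (hA : IsUpperSet A)
    (hC : ∀ ω : Set ι, ω ∈ C ↔ (ω ∈ A ∧ {x : ι | Equiv.swap e j x ∈ ω} ∈ A) ∨ (e ∈ ω ∧ j ∉ ω ∧ (ω ∈ A ∨ {x : ι | Equiv.swap e j x ∈ ω} ∈ A))) :
    IsUpperSet C := by
  intro ω ω' hle hω
  rw [hC] at hω ⊢
  -- the swap is monotone on configurations with the same `e, j`-type; we argue by cases on the types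
  have mono_swap : ∀ {α β : Set ι}, α ⊆ β → {x : ι | Equiv.swap e j x ∈ α} ⊆ {x : ι | Equiv.swap e j x ∈ β} :=
    fun h x hx => h hx
  by_cases he' : e ∈ ω' <;> by_cases hj' : j ∈ ω'
  · -- ω' of type "both": fixed by the swap; it contains ω or ω^τ-images suitably
    have hfix : {x : ι | Equiv.swap e j x ∈ ω'} = ω' := swapSet_eq_self (iff_of_true he' hj')
    left
    rcases hω with ⟨h1, _⟩ | ⟨he, hj, h1 | h1⟩
    · exact ⟨hA hle h1, hfix.symm ▸ hA hle h1⟩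
    · exact ⟨hA hle h1, hfix.symm ▸ hA hle h1⟩
    · -- ω ∈? no: ω^τ ∈ A and ω^τ ⊆ ω' since ω ∖ {e} ⊆ ω' and j ∈ ω'
      have hsub : {x : ι | Equiv.swap e j x ∈ ω} ⊆ ω' := by
        intro x hx
        rw [Set.mem_setOf_eq] at hx
        by_cases hxe : x = e
        · exact hxe ▸ he'
        · by_cases hxj : x = j
          · exact hxj ▸ hj'
          · rw [Equiv.swap_apply_of_ne_of_ne hxe hxj] at hx; exact hle hx
      exact ⟨hA hsub h1, hfix.symm ▸ hA hsub h1⟩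
  · -- ω' of type "e only"
    right
    refine ⟨he', hj', ?_⟩
    rcases hω with ⟨h1, _⟩ | ⟨he, hj, h1 | h1⟩
    · exact Or.inl (hA hle h1)
    · exact Or.inl (hA hle h1)
    · refine Or.inr (hA ?_ h1)
      intro x hx
      rw [Set.mem_setOf_eq] at hx ⊢
      by_cases hxe : x = e
      · subst hxe; rw [Equiv.swap_apply_left] at hx; exact absurd hx hj
      · by_cases hxj : x = j
        · subst hxj; rw [Equiv.swap_apply_right]; exact he'
        · rw [Equiv.swap_apply_of_ne_of_ne hxe hxj] at hx ⊢; exact hle hx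
  · -- ω' of type "j only": then ω has `e ∉ ω` (else e ∈ ω'), so ω is of type "j only" or "neither"
    have heω : e ∉ ω := fun h => he' (hle h)
    left
    rcases hω with ⟨h1, h2⟩ | ⟨he, _, _⟩
    · refine ⟨hA hle h1, hA ?_ h2⟩
      intro x hx
      rw [Set.mem_setOf_eq] at hx ⊢
      by_cases hxe : x = e
      · subst hxe; rw [Equiv.swap_apply_left]; exact hj'
      · by_cases hxj : x = j
        · subst hxj; rw [Equiv.swap_apply_right] at hx; exact absurd hx heω
        · rw [Equiv.swap_apply_of_ne_of_ne hxe hxj] at hx ⊢; exact hle hx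
    · exact absurd he heω
  · -- ω' of type "neither": then ω of type neither too
    have hfix : {x : ι | Equiv.swap e j x ∈ ω'} = ω' := swapSet_eq_self (iff_of_false he' hj')
    left
    rcases hω with ⟨h1, _⟩ | ⟨he, _, _⟩
    · exact ⟨hA hle h1, hfix.symm ▸ hA hle h1⟩
    · exact absurd (hle he) he'

omit [Fintype ι] in
/-- The compression of a `G`-determined family (`e, j ∈ G`) is `G`-determined. [folklore] -/
theorem determinedBy_of_compress {e j : ι} {G : Finset ι} (he : e ∈ G) (hj : j ∈ G) {A C : Set (Set ι)}
    (hAG : DeterminedBy A (↑G : Set ι))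
    (hC : ∀ ω : Set ι, ω ∈ C ↔ (ω ∈ A ∧ {x : ι | Equiv.swap e j x ∈ ω} ∈ A) ∨ (e ∈ ω ∧ j ∉ ω ∧ (ω ∈ A ∨ {x : ι | Equiv.swap e j x ∈ ω} ∈ A))) :
    DeterminedBy C (↑G : Set ι) := by
  rw [determinedBy_iff] at hAG ⊢
  intro ω ω' hωω'
  have hsw : {x : ι | Equiv.swap e j x ∈ ω} ∩ ↑G = {x : ι | Equiv.swap e j x ∈ ω'} ∩ ↑G := by
    ext x
    simp only [Set.mem_inter_iff, Set.mem_setOf_eq, Finset.mem_coe]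
    constructor
    · rintro ⟨hx, hxG⟩
      have hτG : Equiv.swap e j x ∈ G := by
        by_cases hxe : x = e
        · subst hxe; rwa [Equiv.swap_apply_left]
        · by_cases hxj : x = j
          · subst hxj; rwa [Equiv.swap_apply_right]
          · rwa [Equiv.swap_apply_of_ne_of_ne hxe hxj]
      have h1 : Equiv.swap e j x ∈ ω ∩ ↑G := ⟨hx, hτG⟩
      rw [hωω'] at h1
      exact ⟨h1.1, hxG⟩
    · rintro ⟨hx, hxG⟩
      have hτG : Equiv.swap e j x ∈ G := by
        by_cases hxe : x = e
        · subst hxe; rwa [Equiv.swap_apply_left]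
        · by_cases hxj : x = j
          · subst hxj; rwa [Equiv.swap_apply_right]
          · rwa [Equiv.swap_apply_of_ne_of_ne hxe hxj]
      have h1 : Equiv.swap e j x ∈ ω' ∩ ↑G := ⟨hx, hτG⟩
      rw [← hωω'] at h1
      exact ⟨h1.1, hxG⟩
  have heq : (e ∈ ω ↔ e ∈ ω') := by
    have := Set.ext_iff.1 hωω' e
    simp only [Set.mem_inter_iff, Finset.mem_coe] at this
    exact ⟨fun h => (this.1 ⟨h, he⟩).1, fun h => (this.2 ⟨h, he⟩).1⟩
  have hjq : (j ∈ ω ↔ j ∈ ω') := by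
    have := Set.ext_iff.1 hωω' j
    simp only [Set.mem_inter_iff, Finset.mem_coe] at this
    exact ⟨fun h => (this.1 ⟨h, hj⟩).1, fun h => (this.2 ⟨h, hj⟩).1⟩
  rw [hC, hC, hAG ω ω' hωω', hAG _ _ hsw, heq, hjq]

/-! ## Orbit counts -/

omit [Fintype ι] in
/-- **On every `τ`-orbit the compression keeps the number of members**: `1_C(ω) + 1_C(ω^τ) = 1_A(ω) + 1_A(ω^τ)`. [folklore] -/
theorem ind_compress_add_ind_compress {e j : ι} {A C : Set (Set ι)}
    (hC : ∀ ω : Set ι, ω ∈ C ↔ (ω ∈ A ∧ {x : ι | Equiv.swap e j x ∈ ω} ∈ A) ∨ (e ∈ ω ∧ j ∉ ω ∧ (ω ∈ A ∨ {x : ι | Equiv.swap e j x ∈ ω} ∈ A)))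
    (ω : Set ι) :
    ind C ω + ind C {x : ι | Equiv.swap e j x ∈ ω} = ind A ω + ind A {x : ι | Equiv.swap e j x ∈ ω} := by
  have hCω := hC ω
  have hCτ := hC {x : ι | Equiv.swap e j x ∈ ω}
  rw [swapSet_swapSet, mem_swapSet_left, mem_swapSet_right] at hCτ
  by_cases he : e ∈ ω <;> by_cases hj : j ∈ ω
  · have hfix : {x : ι | Equiv.swap e j x ∈ ω} = ω := swapSet_eq_self (iff_of_true he hj)
    rw [hfix] at hCω hCτ ⊢
    have : ω ∈ C ↔ ω ∈ A := by rw [hCω]; tauto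
    by_cases hA : ω ∈ A
    · rw [ind_of_mem hA, ind_of_mem (this.2 hA)]
    · rw [ind_of_not_mem hA, ind_of_not_mem (fun h => hA (this.1 h))]
  · -- type "e only": ω ∈ C ↔ ω ∈ A ∨ ω^τ ∈ A;  ω^τ ∈ C ↔ ω^τ ∈ A ∧ ω ∈ A
    have h1 : ω ∈ C ↔ (ω ∈ A ∨ {x : ι | Equiv.swap e j x ∈ ω} ∈ A) := by rw [hCω]; tauto
    have h2 : {x : ι | Equiv.swap e j x ∈ ω} ∈ C ↔ ({x : ι | Equiv.swap e j x ∈ ω} ∈ A ∧ ω ∈ A) := by rw [hCτ]; tauto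
    by_cases hA : ω ∈ A <;> by_cases hA' : {x : ι | Equiv.swap e j x ∈ ω} ∈ A
    · rw [ind_of_mem hA, ind_of_mem hA', ind_of_mem (h1.2 (Or.inl hA)), ind_of_mem (h2.2 ⟨hA', hA⟩)]
    · rw [ind_of_mem hA, ind_of_not_mem hA', ind_of_mem (h1.2 (Or.inl hA)), ind_of_not_mem (fun h => hA' (h2.1 h).1)]
    · rw [ind_of_not_mem hA, ind_of_mem hA', ind_of_mem (h1.2 (Or.inr hA')), ind_of_not_mem (fun h => hA (h2.1 h).2)]; ring
    · rw [ind_of_not_mem hA, ind_of_not_mem hA', ind_of_not_mem (fun h => (h1.1 h).elim hA hA'),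
        ind_of_not_mem (fun h => hA (h2.1 h).2)]
  · -- type "j only": symmetric
    have h1 : ω ∈ C ↔ (ω ∈ A ∧ {x : ι | Equiv.swap e j x ∈ ω} ∈ A) := by rw [hCω]; tauto
    have h2 : {x : ι | Equiv.swap e j x ∈ ω} ∈ C ↔ ({x : ι | Equiv.swap e j x ∈ ω} ∈ A ∨ ω ∈ A) := by rw [hCτ]; tauto
    by_cases hA : ω ∈ A <;> by_cases hA' : {x : ι | Equiv.swap e j x ∈ ω} ∈ A
    · rw [ind_of_mem hA, ind_of_mem hA', ind_of_mem (h1.2 ⟨hA, hA'⟩), ind_of_mem (h2.2 (Or.inl hA'))]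
    · rw [ind_of_mem hA, ind_of_not_mem hA', ind_of_not_mem (fun h => hA' (h1.1 h).2), ind_of_mem (h2.2 (Or.inr hA))]; ring
    · rw [ind_of_not_mem hA, ind_of_mem hA', ind_of_not_mem (fun h => hA (h1.1 h).1), ind_of_mem (h2.2 (Or.inl hA'))]
    · rw [ind_of_not_mem hA, ind_of_not_mem hA', ind_of_not_mem (fun h => hA (h1.1 h).1),
        ind_of_not_mem (fun h => (h2.1 h).elim hA' hA)]
  · have hfix : {x : ι | Equiv.swap e j x ∈ ω} = ω := swapSet_eq_self (iff_of_false he hj)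
    rw [hfix] at hCω hCτ ⊢
    have : ω ∈ C ↔ ω ∈ A := by rw [hCω]; tauto
    by_cases hA : ω ∈ A
    · rw [ind_of_mem hA, ind_of_mem (this.2 hA)]
    · rw [ind_of_not_mem hA, ind_of_not_mem (fun h => hA (this.1 h))]

omit [Fintype ι] in
/-- **Opposite compressions do not increase common members on an orbit**: for the compression `C` of `A` towards `e` and `C'` of `B` towards
`j`, `1_{C∩C'}(ω) + 1_{C∩C'}(ω^τ) ≤ 1_{A∩B}(ω) + 1_{A∩B}(ω^τ)` (memo Lemma 3 (c)). [this work] -/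
theorem ind_compress_inter_le {e j : ι} {A B C C' : Set (Set ι)}
    (hC : ∀ ω : Set ι, ω ∈ C ↔ (ω ∈ A ∧ {x : ι | Equiv.swap e j x ∈ ω} ∈ A) ∨ (e ∈ ω ∧ j ∉ ω ∧ (ω ∈ A ∨ {x : ι | Equiv.swap e j x ∈ ω} ∈ A)))
    (hC' : ∀ ω : Set ι, ω ∈ C' ↔ (ω ∈ B ∧ {x : ι | Equiv.swap e j x ∈ ω} ∈ B) ∨ (j ∈ ω ∧ e ∉ ω ∧ (ω ∈ B ∨ {x : ι | Equiv.swap e j x ∈ ω} ∈ B)))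
    (ω : Set ι) :
    ind (C ∩ C') ω + ind (C ∩ C') {x : ι | Equiv.swap e j x ∈ ω} ≤
      ind (A ∩ B) ω + ind (A ∩ B) {x : ι | Equiv.swap e j x ∈ ω} := by
  have hCω := hC ω
  have hCτ := hC {x : ι | Equiv.swap e j x ∈ ω}
  have hC'ω := hC' ω
  have hC'τ := hC' {x : ι | Equiv.swap e j x ∈ ω}
  rw [swapSet_swapSet, mem_swapSet_left, mem_swapSet_right] at hCτ hC'τ
  have i00 : ∀ (X : Set (Set ι)) (α : Set ι), 0 ≤ ind X α := fun X α => by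
    unfold ind; split_ifs <;> norm_num
  by_cases he : e ∈ ω <;> by_cases hj : j ∈ ω
  · have hfix : {x : ι | Equiv.swap e j x ∈ ω} = ω := swapSet_eq_self (iff_of_true he hj)
    rw [hfix] at hCω hC'ω ⊢
    have h1 : ω ∈ C ∩ C' ↔ ω ∈ A ∩ B := by
      constructor
      · rintro ⟨gC, gC'⟩
        rw [hCω] at gC
        rw [hC'ω] at gC'
        exact ⟨gC.elim (fun h => h.1) (fun h => (h.2.1 hj).elim), gC'.elim (fun h => h.1) (fun h => (h.2.1 he).elim)⟩
      · rintro ⟨gA, gB⟩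
        exact ⟨hCω.2 (Or.inl ⟨gA, gA⟩), hC'ω.2 (Or.inl ⟨gB, gB⟩)⟩
    by_cases hAB : ω ∈ A ∩ B
    · rw [ind_of_mem hAB, ind_of_mem (h1.2 hAB)]
    · rw [ind_of_not_mem hAB, ind_of_not_mem (fun h => hAB (h1.1 h))]
  · -- type "e only"
    have h1 : ω ∈ C ∩ C' → (ω ∈ B ∧ {x : ι | Equiv.swap e j x ∈ ω} ∈ B) ∧ (ω ∈ A ∨ {x : ι | Equiv.swap e j x ∈ ω} ∈ A) := by
      rintro ⟨gC, gC'⟩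
      rw [hCω] at gC
      rw [hC'ω] at gC'
      refine ⟨?_, ?_⟩
      · rcases gC' with h | ⟨hjω, _, _⟩
        · exact h
        · exact absurd hjω hj
      · rcases gC with ⟨h, _⟩ | ⟨_, _, h⟩
        · exact Or.inl h
        · exact h
    have h2 : {x : ι | Equiv.swap e j x ∈ ω} ∈ C ∩ C' →
        ({x : ι | Equiv.swap e j x ∈ ω} ∈ A ∧ ω ∈ A) ∧ ({x : ι | Equiv.swap e j x ∈ ω} ∈ B ∨ ω ∈ B) := by
      rintro ⟨gC, gC'⟩
      rw [hCτ] at gC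
      rw [hC'τ] at gC'
      refine ⟨?_, ?_⟩
      · rcases gC with h | ⟨hjω, _, _⟩
        · exact h
        · exact absurd hjω hj
      · rcases gC' with ⟨h, _⟩ | ⟨_, _, h⟩
        · exact Or.inl h
        · exact h
    by_cases g1 : ω ∈ C ∩ C' <;> by_cases g2 : {x : ι | Equiv.swap e j x ∈ ω} ∈ C ∩ C'
    · rw [ind_of_mem g1, ind_of_mem g2, ind_of_mem (Set.mem_inter (h2 g2).1.2 (h1 g1).1.1), ind_of_mem (Set.mem_inter (h2 g2).1.1 (h1 g1).1.2)]
    · rw [ind_of_mem g1, ind_of_not_mem g2, add_zero]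
      rcases (h1 g1).2 with hA | hA
      · rw [ind_of_mem (Set.mem_inter hA (h1 g1).1.1)]; linarith [i00 (A ∩ B) {x : ι | Equiv.swap e j x ∈ ω}]
      · rw [ind_of_mem (Set.mem_inter hA (h1 g1).1.2)]; linarith [i00 (A ∩ B) ω]
    · rw [ind_of_not_mem g1, ind_of_mem g2, zero_add]
      rcases (h2 g2).2 with hB | hB
      · rw [ind_of_mem (Set.mem_inter (h2 g2).1.1 hB)]; linarith [i00 (A ∩ B) ω]
      · rw [ind_of_mem (Set.mem_inter (h2 g2).1.2 hB)]; linarith [i00 (A ∩ B) {x : ι | Equiv.swap e j x ∈ ω}]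
    · rw [ind_of_not_mem g1, ind_of_not_mem g2]; linarith [i00 (A ∩ B) ω, i00 (A ∩ B) {x : ι | Equiv.swap e j x ∈ ω}]
  · -- type "j only"
    have h1 : ω ∈ C ∩ C' → (ω ∈ A ∧ {x : ι | Equiv.swap e j x ∈ ω} ∈ A) ∧ (ω ∈ B ∨ {x : ι | Equiv.swap e j x ∈ ω} ∈ B) := by
      rintro ⟨gC, gC'⟩
      rw [hCω] at gC
      rw [hC'ω] at gC'
      refine ⟨?_, ?_⟩
      · rcases gC with h | ⟨heω, _, _⟩
        · exact h
        · exact absurd heω he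
      · rcases gC' with ⟨h, _⟩ | ⟨_, _, h⟩
        · exact Or.inl h
        · exact h
    have h2 : {x : ι | Equiv.swap e j x ∈ ω} ∈ C ∩ C' →
        ({x : ι | Equiv.swap e j x ∈ ω} ∈ A ∨ ω ∈ A) ∧ ({x : ι | Equiv.swap e j x ∈ ω} ∈ B ∧ ω ∈ B) := by
      rintro ⟨gC, gC'⟩
      rw [hCτ] at gC
      rw [hC'τ] at gC'
      refine ⟨?_, ?_⟩
      · rcases gC with ⟨h, _⟩ | ⟨_, _, h⟩
        · exact Or.inl h
        · exact h
      · rcases gC' with h | ⟨heω, _, _⟩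
        · exact h
        · exact absurd heω he
    by_cases g1 : ω ∈ C ∩ C' <;> by_cases g2 : {x : ι | Equiv.swap e j x ∈ ω} ∈ C ∩ C'
    · rw [ind_of_mem g1, ind_of_mem g2, ind_of_mem (Set.mem_inter (h1 g1).1.1 (h2 g2).2.2), ind_of_mem (Set.mem_inter (h1 g1).1.2 (h2 g2).2.1)]
    · rw [ind_of_mem g1, ind_of_not_mem g2, add_zero]
      rcases (h1 g1).2 with hB | hB
      · rw [ind_of_mem (Set.mem_inter (h1 g1).1.1 hB)]; linarith [i00 (A ∩ B) {x : ι | Equiv.swap e j x ∈ ω}]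
      · rw [ind_of_mem (Set.mem_inter (h1 g1).1.2 hB)]; linarith [i00 (A ∩ B) ω]
    · rw [ind_of_not_mem g1, ind_of_mem g2, zero_add]
      rcases (h2 g2).1 with hA | hA
      · rw [ind_of_mem (Set.mem_inter hA (h2 g2).2.1)]; linarith [i00 (A ∩ B) ω]
      · rw [ind_of_mem (Set.mem_inter hA (h2 g2).2.2)]; linarith [i00 (A ∩ B) {x : ι | Equiv.swap e j x ∈ ω}]
    · rw [ind_of_not_mem g1, ind_of_not_mem g2]; linarith [i00 (A ∩ B) ω, i00 (A ∩ B) {x : ι | Equiv.swap e j x ∈ ω}]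
  · have hfix : {x : ι | Equiv.swap e j x ∈ ω} = ω := swapSet_eq_self (iff_of_false he hj)
    rw [hfix] at hCω hC'ω ⊢
    have h1 : ω ∈ C ∩ C' ↔ ω ∈ A ∩ B := by
      constructor
      · rintro ⟨gC, gC'⟩
        rw [hCω] at gC
        rw [hC'ω] at gC'
        exact ⟨gC.elim (fun h => h.1) (fun h => (he h.1).elim), gC'.elim (fun h => h.1) (fun h => (hj h.1).elim)⟩
      · rintro ⟨gA, gB⟩
        exact ⟨hCω.2 (Or.inl ⟨gA, gA⟩), hC'ω.2 (Or.inl ⟨gB, gB⟩)⟩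
    by_cases hAB : ω ∈ A ∩ B
    · rw [ind_of_mem hAB, ind_of_mem (h1.2 hAB)]
    · rw [ind_of_not_mem hAB, ind_of_not_mem (fun h => hAB (h1.1 h))]

end SahiOneStep

end Summit.CriticalPhenomena.PercolationContinuityZ3.Theorems
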